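import Mathlib

/-! # TiltedLandingLaw421RealRolleDescent — real Rolle for real-on-ℝ holomorphic functions (kernel lemmas for the c14 LINEAGE / DESCENT typing)
(C4 «kernel desk» rh-idea-6 g21; W-07 crux `TiltedLandingLaw421`, support only.)
Between two real zeros `a < b` of a function `g : ℂ → ℂ` that is differentiable at every real point and REAL on ℝ,
there is a real zero of `deriv g` in `(a, b)`.  Specialised to `g = iteratedDeriv j f` this is the existence half of the
Rolle DESCENT map from hull gaps of level `j` to real zeros of level `j + 1` (§X words: «one zero of f⁽ʲ⁺¹⁾ per gap» is the
open uniqueness half).  No engine data, no census quantity.  RH is not proved. -/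

namespace RhW07.C14.Descent

open Complex Set

/-- the derivative along ℝ of a function real on ℝ is real: if `g` is differentiable at the real point `c` and
`(g x).im = 0` for all real `x`, then `(deriv g c).im = 0`. -/
theorem deriv_im_eq_zero_of_real {g : ℂ → ℂ} {c : ℝ} (hg : DifferentiableAt ℂ g (c : ℂ))
    (hreal : ∀ x : ℝ, (g x).im = 0) : (deriv g (c : ℂ)).im = 0 := by
  -- `Im w = Re ((-I) * w)`, so differentiate the real function `x ↦ Re ((-I) * g x)`, which vanishes identically
  have h2 : HasDerivAt (fun x : ℝ => ((-I) * g (x : ℂ)).re) ((-I) * deriv g (c : ℂ)).re c :=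
    ((hg.hasDerivAt).const_mul (-I)).real_of_complex
  have h3 : (fun x : ℝ => ((-I) * g (x : ℂ)).re) = fun _ => (0 : ℝ) := by
    funext x; simp [Complex.mul_re, hreal x]
  rw [h3] at h2
  have h4 : ((-I) * deriv g (c : ℂ)).re = 0 := h2.unique (hasDerivAt_const c (0 : ℝ))
  simpa [Complex.mul_re] using h4

/-- REAL ROLLE: `g : ℂ → ℂ` differentiable at every real point and real on ℝ, `a < b` real with `g a = 0 = g b`
⟹ some real `c ∈ (a, b)` has `deriv g c = 0`. -/
theorem exists_real_zero_deriv_of_real {g : ℂ → ℂ} (hg : ∀ x : ℝ, DifferentiableAt ℂ g (x : ℂ))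
    (hreal : ∀ x : ℝ, (g x).im = 0) {a b : ℝ} (hab : a < b) (ha : g a = 0) (hb : g b = 0) :
    ∃ c : ℝ, c ∈ Ioo a b ∧ deriv g (c : ℂ) = 0 := by
  -- the real function φ x = Re g x
  set φ : ℝ → ℝ := fun x => (g (x : ℂ)).re with hφ
  have hderiv : ∀ x : ℝ, HasDerivAt φ (deriv g (x : ℂ)).re x := fun x =>
    (hg x).hasDerivAt.real_of_complex
  have hcont : ContinuousOn φ (Icc a b) := fun x _ => (hderiv x).continuousAt.continuousWithinAt
  have hends : φ a = φ b := by simp [hφ, ha, hb]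
  obtain ⟨c, hc, hc0⟩ := exists_deriv_eq_zero hab hcont hends
  refine ⟨c, hc, ?_⟩
  have hre : (deriv g (c : ℂ)).re = 0 := by rw [← (hderiv c).deriv]; exact hc0
  have him : (deriv g (c : ℂ)).im = 0 := deriv_im_eq_zero_of_real (hg c) hreal
  exact Complex.ext hre him

/-- the iterated-derivative form used by the tent lineage: for `f` differentiable everywhere with `iteratedDeriv j f`
real on ℝ, two real zeros `a < b` of `iteratedDeriv j f` enclose a real zero of `iteratedDeriv (j + 1) f`. -/
theorem exists_real_zero_iteratedDeriv_succ {f : ℂ → ℂ} (hf : Differentiable ℂ f) {j : ℕ}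
    (hreal : ∀ x : ℝ, (iteratedDeriv j f x).im = 0) {a b : ℝ} (hab : a < b)
    (ha : iteratedDeriv j f a = 0) (hb : iteratedDeriv j f b = 0) :
    ∃ c : ℝ, c ∈ Ioo a b ∧ iteratedDeriv (j + 1) f (c : ℂ) = 0 := by
  have hg : ∀ x : ℝ, DifferentiableAt ℂ (iteratedDeriv j f) (x : ℂ) := fun x =>
    ((hf.contDiff (n := ⊤)).differentiable_iteratedDeriv j (WithTop.coe_lt_top _)).differentiableAt
  obtain ⟨c, hc, hc0⟩ := exists_real_zero_deriv_of_real hg hreal hab ha hb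
  exact ⟨c, hc, by rw [iteratedDeriv_succ]; exact hc0⟩

/-- COUNTED ROLLE (the descent count): if `g : ℂ → ℂ` is differentiable at every real point and real on ℝ, and `P` is a
finite set of real zeros of `g`, then there is a finite set `Q` of real zeros of `deriv g` with `P.card ≤ Q.card + 1`, every
member of `Q` lying strictly between two members of `P` (so inside the open hull of `P`).  This is the multiplicity-free
TOOTH ⟶ GAP-ZERO count behind the tent heredity words («k teeth at level j force k − 1 real zeros at level j + 1 in the hull»). -/
theorem exists_finset_real_zeros_deriv_of_real {g : ℂ → ℂ} (hg : ∀ x : ℝ, DifferentiableAt ℂ g (x : ℂ))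
    (hreal : ∀ x : ℝ, (g x).im = 0) (P : Finset ℝ) (hP : ∀ p ∈ P, g (p : ℂ) = 0) :
    ∃ Q : Finset ℝ, (∀ q ∈ Q, deriv g (q : ℂ) = 0) ∧ P.card ≤ Q.card + 1 ∧
      (∀ q ∈ Q, ∃ p ∈ P, q < p) ∧ (∀ q ∈ Q, ∃ p ∈ P, p < q) := by
  classical
  induction P using Finset.induction_on_max with
  | empty => exact ⟨∅, by simp, by simp, by simp, by simp⟩
  | insert a s hlt ih =>
    have ha : a ∉ s := fun h => lt_irrefl a (hlt a h)
    have hPs : ∀ p ∈ s, g (p : ℂ) = 0 := fun p hp => hP p (Finset.mem_insert_of_mem hp)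
    have hga : g (a : ℂ) = 0 := hP a (Finset.mem_insert_self a s)
    obtain ⟨Q, hQ0, hcard, hup, hlow⟩ := ih hPs
    by_cases hs : s.Nonempty
    · -- Rolle between the old maximum `m` and the new top zero `a`
      set m : ℝ := s.max' hs with hm
      have hms : m ∈ s := Finset.max'_mem s hs
      have hma : m < a := hlt m hms
      obtain ⟨c, hc, hc0⟩ := exists_real_zero_deriv_of_real hg hreal hma (hPs m hms) hga
      have hcQ : c ∉ Q := by
        intro hcq
        obtain ⟨p, hp, hcp⟩ := hup c hcq
        have : p ≤ m := Finset.le_max' s p hp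
        exact lt_irrefl c (lt_of_lt_of_le (lt_of_lt_of_le hcp this) (le_of_lt hc.1))
      refine ⟨insert c Q, ?_, ?_, ?_, ?_⟩
      · intro q hq
        rcases Finset.mem_insert.mp hq with rfl | hq
        · exact hc0
        · exact hQ0 q hq
      · rw [Finset.card_insert_of_notMem ha, Finset.card_insert_of_notMem hcQ]; omega
      · intro q hq
        rcases Finset.mem_insert.mp hq with rfl | hq
        · exact ⟨a, Finset.mem_insert_self a s, hc.2⟩
        · obtain ⟨p, hp, hqp⟩ := hup q hq
          exact ⟨p, Finset.mem_insert_of_mem hp, hqp⟩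
      · intro q hq
        rcases Finset.mem_insert.mp hq with rfl | hq
        · exact ⟨m, Finset.mem_insert_of_mem hms, hc.1⟩
        · obtain ⟨p, hp, hpq⟩ := hlow q hq
          exact ⟨p, Finset.mem_insert_of_mem hp, hpq⟩
    · -- `s = ∅`: one zero, nothing to produce
      have hs0 : s = ∅ := Finset.not_nonempty_iff_eq_empty.mp hs
      subst hs0
      exact ⟨∅, by simp, by simp, by simp, by simp⟩

/-- iterated-derivative form of the counted Rolle: `k` distinct real zeros of `iteratedDeriv j f` (real on ℝ) force at
least `k − 1` distinct real zeros of `iteratedDeriv (j + 1) f`, each strictly between two of the given zeros. -/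
theorem exists_finset_real_zeros_iteratedDeriv_succ {f : ℂ → ℂ} (hf : Differentiable ℂ f) {j : ℕ}
    (hreal : ∀ x : ℝ, (iteratedDeriv j f x).im = 0) (P : Finset ℝ)
    (hP : ∀ p ∈ P, iteratedDeriv j f (p : ℂ) = 0) :
    ∃ Q : Finset ℝ, (∀ q ∈ Q, iteratedDeriv (j + 1) f (q : ℂ) = 0) ∧ P.card ≤ Q.card + 1 ∧
      (∀ q ∈ Q, ∃ p ∈ P, q < p) ∧ (∀ q ∈ Q, ∃ p ∈ P, p < q) := by
  have hg : ∀ x : ℝ, DifferentiableAt ℂ (iteratedDeriv j f) (x : ℂ) := fun x =>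
    ((hf.contDiff (n := ⊤)).differentiable_iteratedDeriv j (WithTop.coe_lt_top _)).differentiableAt
  obtain ⟨Q, hQ0, hcard, hup, hlow⟩ := exists_finset_real_zeros_deriv_of_real hg hreal P hP
  exact ⟨Q, fun q hq => by rw [iteratedDeriv_succ]; exact hQ0 q hq, hcard, hup, hlow⟩

end RhW07.C14.Descent
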